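import Summits.ValiantsHypothesis.ValiantsHypothesis.Theorems.LacunarySymmetroidMatrixDescartesDoorA26WallBubblingDeepValStratumReduction

/-!
# Wall bubbling for `DoorA26` — `TripleStratum26` REDUCED TO SIX CHAIN STATEMENTS, one per multiplicity pattern (bookkeeping)

HONEST FRAMING.  Obligation (W) `stub_weylFaces` of `Cruxes/DoorA26/Lines/wall_bubbling.lean` (crux `DoorA26`, stmt-ValiantsHypothesis-19979; OPEN,
typed, never asserted); statement file `Cruxes/DoorA26/Lines/wall_bubbling_ConfluentDoor.lean` rev 13,
`TripleStratum26 := ∀ δ ∈ SortedSimplex, (∃ i j k distinct, δ i = δ j ∧ δ i = δ k) → (value-generic) → δ ∉ closure TwentyLocus` — the fourth OPEN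
hypothesis of the (W) ledger.  W1 seat val-sym-door-p2 g15 (#91); the triple analogue of W1 #44 `weylFaces_deepVal_of_chains`.  With the predicates
INLINED VERBATIM (`SortedSimplex`, `TwentyLocus` the Theorems-side copies), **`tripleStratum26_of_chains (h3111) (h321) (h33) (h411) (h42) (h51) :
<TripleStratum26 inlined>`**, where each hypothesis is a CHAIN STATEMENT in sequence currency at a normal position:

* `h3111` — triple at `3,4,5`, three simple values at `0,1,2`, the four values 2-Sidon (its single-cluster branch is #89 `no_twenty_window_weylTriple`);
* `h321` — pair at `0,1`, single at `2`, triple at `3,4,5`, the three values 2-Sidon;  * `h33` — triples at `0,1,2` and `3,4,5`, two distinct values;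
* `h411` — simples at `0,1`, quadruple at `2,3,4,5`, three values 2-Sidon;  * `h42` — pair at `0,1`, quadruple at `2..5`;  * `h51` — single at `0`,
  quintuple at `1..5`.  (The pattern [6] is impossible in the sorted simplex: `δ 0 = 0 ≠ 1 = δ 5`.)

PROOF (bookkeeping, #44's pattern): entrance `δ ∈ closure TwentyLocus ⇒` a sequence of genuine pencils with twenty log-zeros
(`twenty_log_zeros_of_mem_twentyLocus`), the three complementary letters, eight cases on which of them share the triple's value and how they
coincide among themselves, an injective relabelling `![…]` (`injective_vec6`, `Fintype.sum_bijective`) and the transfer of value-genericity to the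
distinct values.  Every hypothesis is OPEN; nothing is asserted.  Registers unchanged; (W), `ConfluentDoor26`, `NoTightChain26NC`, `DoorA26` 19979,
18050 OPEN; nothing on VP ≠ VNP.  Def-free.  `--supports stmt-ValiantsHypothesis-19979 --as helper`.
-/

-- `Summit.ValiantsHypothesis.ValiantsHypothesis.…` repeats a component by the D-0017 layout
-- (single-conjunct summit), which the `dupNamespace` linter flags; the name is mandated.
set_option linter.dupNamespace false

namespace Summit.ValiantsHypothesis.ValiantsHypothesis.Theorems.LacunarySymmetroidMatrixDescartes.WallBubbling

open Finset Filter Topology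
open Bubbling (polar TwentyLocus SortedSimplex)
open scoped BigOperators

/-- Transfer of value-genericity to an injective family of values. [this work] -/
theorem valueGeneric_transfer {r : ℕ} (δ : Fin 6 → ℝ)
    (hV : ∀ a b c d : Fin 6, δ a + δ b = δ c + δ d → (δ a = δ c ∧ δ b = δ d) ∨ (δ a = δ d ∧ δ b = δ c))
    (e : Fin r → Fin 6) (hinj : ∀ x y : Fin r, δ (e x) = δ (e y) → x = y) :
    ∀ a b c d : Fin r, δ (e a) + δ (e b) = δ (e c) + δ (e d) → (a = c ∧ b = d) ∨ (a = d ∧ b = c) := by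
  intro a b c d h
  rcases hV _ _ _ _ h with ⟨h1, h2⟩ | ⟨h1, h2⟩
  · exact Or.inl ⟨hinj _ _ h1, hinj _ _ h2⟩
  · exact Or.inr ⟨hinj _ _ h1, hinj _ _ h2⟩

/-- **`TripleStratum26` REDUCES TO SIX CHAIN STATEMENTS** (predicates inlined verbatim); see the module docstring. [this work] -/
theorem tripleStratum26_of_chains
    (h3111 : ∀ (δs : ℕ → Fin 6 → ℝ) (δ0 : Fin 6 → ℝ), (∀ l, Tendsto (fun ν => δs ν l) atTop (𝓝 (δ0 l))) →
      δ0 4 = δ0 3 → δ0 5 = δ0 3 →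
      (∀ a b c d : Fin 4, δ0 a.castSucc.castSucc + δ0 b.castSucc.castSucc = δ0 c.castSucc.castSucc + δ0 d.castSucc.castSucc →
        (a = c ∧ b = d) ∨ (a = d ∧ b = c)) →
      ∀ (U : ℕ → Fin 6 → Matrix (Fin 2) (Fin 2) ℝ), (∀ ν l, (U ν l).IsSymm) →
      (∀ ν, ∃ t, (∑ l, Real.exp (δs ν l * t) • U ν l).det ≠ 0) →
      ∀ (z : ℕ → Fin 20 → ℝ), (∀ ν, StrictMono (z ν)) → (∀ ν i, (∑ l, Real.exp (δs ν l * z ν i) • U ν l).det = 0) → False)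
    (h321 : ∀ (δs : ℕ → Fin 6 → ℝ) (δ0 : Fin 6 → ℝ), (∀ l, Tendsto (fun ν => δs ν l) atTop (𝓝 (δ0 l))) →
      δ0 1 = δ0 0 → δ0 4 = δ0 3 → δ0 5 = δ0 3 →
      (∀ a b c d : Fin 3, δ0 ((![0, 2, 3] : Fin 3 → Fin 6) a) + δ0 ((![0, 2, 3] : Fin 3 → Fin 6) b)
          = δ0 ((![0, 2, 3] : Fin 3 → Fin 6) c) + δ0 ((![0, 2, 3] : Fin 3 → Fin 6) d) → (a = c ∧ b = d) ∨ (a = d ∧ b = c)) →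
      ∀ (U : ℕ → Fin 6 → Matrix (Fin 2) (Fin 2) ℝ), (∀ ν l, (U ν l).IsSymm) →
      (∀ ν, ∃ t, (∑ l, Real.exp (δs ν l * t) • U ν l).det ≠ 0) →
      ∀ (z : ℕ → Fin 20 → ℝ), (∀ ν, StrictMono (z ν)) → (∀ ν i, (∑ l, Real.exp (δs ν l * z ν i) • U ν l).det = 0) → False)
    (h33 : ∀ (δs : ℕ → Fin 6 → ℝ) (δ0 : Fin 6 → ℝ), (∀ l, Tendsto (fun ν => δs ν l) atTop (𝓝 (δ0 l))) →
      δ0 1 = δ0 0 → δ0 2 = δ0 0 → δ0 4 = δ0 3 → δ0 5 = δ0 3 → δ0 0 ≠ δ0 3 →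
      ∀ (U : ℕ → Fin 6 → Matrix (Fin 2) (Fin 2) ℝ), (∀ ν l, (U ν l).IsSymm) →
      (∀ ν, ∃ t, (∑ l, Real.exp (δs ν l * t) • U ν l).det ≠ 0) →
      ∀ (z : ℕ → Fin 20 → ℝ), (∀ ν, StrictMono (z ν)) → (∀ ν i, (∑ l, Real.exp (δs ν l * z ν i) • U ν l).det = 0) → False)
    (h411 : ∀ (δs : ℕ → Fin 6 → ℝ) (δ0 : Fin 6 → ℝ), (∀ l, Tendsto (fun ν => δs ν l) atTop (𝓝 (δ0 l))) →
      δ0 3 = δ0 2 → δ0 4 = δ0 2 → δ0 5 = δ0 2 →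
      (∀ a b c d : Fin 3, δ0 a.castSucc.castSucc.castSucc + δ0 b.castSucc.castSucc.castSucc
          = δ0 c.castSucc.castSucc.castSucc + δ0 d.castSucc.castSucc.castSucc → (a = c ∧ b = d) ∨ (a = d ∧ b = c)) →
      ∀ (U : ℕ → Fin 6 → Matrix (Fin 2) (Fin 2) ℝ), (∀ ν l, (U ν l).IsSymm) →
      (∀ ν, ∃ t, (∑ l, Real.exp (δs ν l * t) • U ν l).det ≠ 0) →
      ∀ (z : ℕ → Fin 20 → ℝ), (∀ ν, StrictMono (z ν)) → (∀ ν i, (∑ l, Real.exp (δs ν l * z ν i) • U ν l).det = 0) → False)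
    (h42 : ∀ (δs : ℕ → Fin 6 → ℝ) (δ0 : Fin 6 → ℝ), (∀ l, Tendsto (fun ν => δs ν l) atTop (𝓝 (δ0 l))) →
      δ0 1 = δ0 0 → δ0 3 = δ0 2 → δ0 4 = δ0 2 → δ0 5 = δ0 2 → δ0 0 ≠ δ0 2 →
      ∀ (U : ℕ → Fin 6 → Matrix (Fin 2) (Fin 2) ℝ), (∀ ν l, (U ν l).IsSymm) →
      (∀ ν, ∃ t, (∑ l, Real.exp (δs ν l * t) • U ν l).det ≠ 0) →
      ∀ (z : ℕ → Fin 20 → ℝ), (∀ ν, StrictMono (z ν)) → (∀ ν i, (∑ l, Real.exp (δs ν l * z ν i) • U ν l).det = 0) → False)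
    (h51 : ∀ (δs : ℕ → Fin 6 → ℝ) (δ0 : Fin 6 → ℝ), (∀ l, Tendsto (fun ν => δs ν l) atTop (𝓝 (δ0 l))) →
      δ0 2 = δ0 1 → δ0 3 = δ0 1 → δ0 4 = δ0 1 → δ0 5 = δ0 1 → δ0 0 ≠ δ0 1 →
      ∀ (U : ℕ → Fin 6 → Matrix (Fin 2) (Fin 2) ℝ), (∀ ν l, (U ν l).IsSymm) →
      (∀ ν, ∃ t, (∑ l, Real.exp (δs ν l * t) • U ν l).det ≠ 0) →
      ∀ (z : ℕ → Fin 20 → ℝ), (∀ ν, StrictMono (z ν)) → (∀ ν i, (∑ l, Real.exp (δs ν l * z ν i) • U ν l).det = 0) → False) :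
    ∀ δ ∈ SortedSimplex, (∃ i j k : Fin 6, i ≠ j ∧ i ≠ k ∧ j ≠ k ∧ δ i = δ j ∧ δ i = δ k) →
      (∀ a b c d : Fin 6, δ a + δ b = δ c + δ d → (δ a = δ c ∧ δ b = δ d) ∨ (δ a = δ d ∧ δ b = δ c)) →
      δ ∉ closure TwentyLocus := by
  intro δ hδS htr hV hcl
  classical
  obtain ⟨i, j, k, hij, hik, hjk, hδij, hδik⟩ := htr
  -- (0) entrance
  obtain ⟨δseq, hmem, hlim⟩ := mem_closure_iff_seq_limit.mp hcl
  choose S hS hneS z hz hroot using fun ν => twenty_log_zeros_of_mem_twentyLocus (hmem ν)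
  have hδ : ∀ l, Tendsto (fun ν => δseq ν l) atTop (𝓝 (δ l)) := fun l => (tendsto_pi_nhds.mp hlim) l
  -- reindexing along an injective relabelling
  have reindex : ∀ g : Fin 6 → Fin 6, Function.Injective g →
      (∀ ν, ∃ t, (∑ q, Real.exp (δseq ν (g q) * t) • S ν (g q)).det ≠ 0) ∧
      (∀ ν i', (∑ q, Real.exp (δseq ν (g q) * z ν i') • S ν (g q)).det = 0) := by
    intro g hg
    have hbij : Function.Bijective g := Finite.injective_iff_bijective.mp hg
    have hsumg : ∀ F : Fin 6 → Matrix (Fin 2) (Fin 2) ℝ, ∑ q, F (g q) = ∑ l, F l :=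
      fun F => Fintype.sum_bijective g hbij (fun q => F (g q)) F (fun _ => rfl)
    refine ⟨fun ν => ?_, fun ν i' => ?_⟩
    · obtain ⟨t, ht⟩ := hneS ν
      exact ⟨t, by rw [hsumg (fun l => Real.exp (δseq ν l * t) • S ν l)]; exact ht⟩
    · rw [hsumg (fun l => Real.exp (δseq ν l * z ν i') • S ν l)]
      exact hroot ν i'
  -- how each chain is consumed along a relabelling `g`
  have use : ∀ g : Fin 6 → Fin 6, Function.Injective g →
      (∀ (δs : ℕ → Fin 6 → ℝ) (δ0 : Fin 6 → ℝ), (∀ l, Tendsto (fun ν => δs ν l) atTop (𝓝 (δ0 l))) →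
        δ0 = (fun q => δ (g q)) →
        ∀ (U : ℕ → Fin 6 → Matrix (Fin 2) (Fin 2) ℝ), (∀ ν l, (U ν l).IsSymm) →
        (∀ ν, ∃ t, (∑ l, Real.exp (δs ν l * t) • U ν l).det ≠ 0) →
        ∀ (z : ℕ → Fin 20 → ℝ), (∀ ν, StrictMono (z ν)) → (∀ ν i, (∑ l, Real.exp (δs ν l * z ν i) • U ν l).det = 0) → False) →
      False := by
    intro g hg H
    obtain ⟨hne', hroot'⟩ := reindex g hg
    exact H (fun ν q => δseq ν (g q)) (fun q => δ (g q)) (fun q => hδ _) rfl (fun ν q => S ν (g q)) (fun ν q => hS ν _) hne' z hz hroot'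
  -- the three complementary letters
  obtain ⟨l, hl⟩ : ∃ l : Fin 6, l ∉ ({i, j, k} : Finset (Fin 6)) := by
    have hlt' : ({i, j, k} : Finset (Fin 6)).card < (Finset.univ : Finset (Fin 6)).card :=
      lt_of_le_of_lt Finset.card_le_three (by rw [Finset.card_univ, Fintype.card_fin]; norm_num)
    obtain ⟨l, -, hl⟩ := Finset.exists_mem_notMem_of_card_lt_card hlt'
    exact ⟨l, hl⟩
  obtain ⟨m, hm⟩ : ∃ m : Fin 6, m ∉ ({i, j, k, l} : Finset (Fin 6)) := by
    have hlt' : ({i, j, k, l} : Finset (Fin 6)).card < (Finset.univ : Finset (Fin 6)).card :=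
      lt_of_le_of_lt Finset.card_le_four (by rw [Finset.card_univ, Fintype.card_fin]; norm_num)
    obtain ⟨m, -, hm⟩ := Finset.exists_mem_notMem_of_card_lt_card hlt'
    exact ⟨m, hm⟩
  obtain ⟨n, hn⟩ : ∃ n : Fin 6, n ∉ ({i, j, k, l, m} : Finset (Fin 6)) := by
    have hlt' : ({i, j, k, l, m} : Finset (Fin 6)).card < (Finset.univ : Finset (Fin 6)).card :=
      lt_of_le_of_lt Finset.card_le_five (by rw [Finset.card_univ, Fintype.card_fin]; norm_num)
    obtain ⟨n, -, hn⟩ := Finset.exists_mem_notMem_of_card_lt_card hlt'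
    exact ⟨n, hn⟩
  simp only [Finset.mem_insert, Finset.mem_singleton, not_or] at hl hm hn
  obtain ⟨hli, hlj, hlk⟩ := hl
  obtain ⟨hmi, hmj, hmk, hml⟩ := hm
  obtain ⟨hni, hnj, hnk, hnl, hnm⟩ := hn
  have hδjk : δ j = δ k := hδij.symm.trans hδik
  -- small case tools
  have h2 : ∀ x : Fin 2, x = 0 ∨ x = 1 := by decide
  have h3 : ∀ x : Fin 3, x = 0 ∨ x = 1 ∨ x = 2 := by decide
  have h4 : ∀ x : Fin 4, x = 0 ∨ x = 1 ∨ x = 2 ∨ x = 3 := by decide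
  -- (1) all six letters share the value: impossible in the sorted simplex
  by_cases hL : δ l = δ i <;> by_cases hM : δ m = δ i <;> by_cases hN : δ n = δ i
  · exfalso
    have hg : Function.Injective ![i, j, k, l, m, n] :=
      injective_vec6 i j k l m n hij hik (Ne.symm hli) (Ne.symm hmi) (Ne.symm hni) hjk (Ne.symm hlj) (Ne.symm hmj) (Ne.symm hnj)
        (Ne.symm hlk) (Ne.symm hmk) (Ne.symm hnk) (Ne.symm hml) (Ne.symm hnl) (Ne.symm hnm)
    have hsurj := (Finite.injective_iff_bijective.mp hg).2
    have hall : ∀ x : Fin 6, δ x = δ i := by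
      intro x
      obtain ⟨p, rfl⟩ := hsurj x
      have h6 : ∀ p : Fin 6, p = 0 ∨ p = 1 ∨ p = 2 ∨ p = 3 ∨ p = 4 ∨ p = 5 := by decide
      rcases h6 p with rfl | rfl | rfl | rfl | rfl | rfl
      · rfl
      · exact hδij.symm
      · exact hδik.symm
      · exact hL
      · exact hM
      · exact hN
    obtain ⟨-, h0, h5⟩ := hδS
    have : δ 0 = δ (Fin.last 5) := by rw [hall 0, hall (Fin.last 5)]
    rw [h0, h5] at this
    exact zero_ne_one this
  · -- (2) quintuple `{i,j,k,l,m}`, single `n`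
    refine use ![n, i, j, k, l, m]
      (injective_vec6 n i j k l m hni hnj hnk hnl hnm hij hik (Ne.symm hli) (Ne.symm hmi) hjk (Ne.symm hlj) (Ne.symm hmj)
        (Ne.symm hlk) (Ne.symm hmk) (Ne.symm hml)) ?_
    intro δs δ0 hδs hδ0 U hU hne' z' hz' hroot'
    subst hδ0
    exact h51 δs _ hδs (by simp [hδij]) (by simp [hδik]) (by simp [hL]) (by simp [hM]) (by simpa using hN) U hU hne' z' hz' hroot'
  · -- quintuple `{i,j,k,l,n}`, single `m`
    refine use ![m, i, j, k, l, n]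
      (injective_vec6 m i j k l n hmi hmj hmk hml (Ne.symm hnm) hij hik (Ne.symm hli) (Ne.symm hni) hjk (Ne.symm hlj) (Ne.symm hnj)
        (Ne.symm hlk) (Ne.symm hnk) (Ne.symm hnl)) ?_
    intro δs δ0 hδs hδ0 U hU hne' z' hz' hroot'
    subst hδ0
    exact h51 δs _ hδs (by simp [hδij]) (by simp [hδik]) (by simp [hL]) (by simp [hN]) (by simpa using hM) U hU hne' z' hz' hroot'
  · -- (3) quadruple `{i,j,k,l}`; letters `m, n` off the value
    by_cases hmn : δ m = δ n
    · refine use ![m, n, i, j, k, l]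
        (injective_vec6 m n i j k l (Ne.symm hnm) hmi hmj hmk hml hni hnj hnk hnl hij hik (Ne.symm hli) hjk (Ne.symm hlj) (Ne.symm hlk)) ?_
      intro δs δ0 hδs hδ0 U hU hne' z' hz' hroot'
      subst hδ0
      exact h42 δs _ hδs (by simp [hmn]) (by simp [hδij]) (by simp [hδik]) (by simp [hL]) (by simpa using hM) U hU hne' z' hz' hroot'
    · refine use ![m, n, i, j, k, l]
        (injective_vec6 m n i j k l (Ne.symm hnm) hmi hmj hmk hml hni hnj hnk hnl hij hik (Ne.symm hli) hjk (Ne.symm hlj) (Ne.symm hlk)) ?_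
      intro δs δ0 hδs hδ0 U hU hne' z' hz' hroot'
      subst hδ0
      refine h411 δs _ hδs (by simp [hδij]) (by simp [hδik]) (by simp [hL]) ?_ U hU hne' z' hz' hroot'
      refine valueGeneric_transfer δ hV (fun a => ![m, n, i, j, k, l] a.castSucc.castSucc.castSucc) ?_
      intro x y hxy
      rcases h3 x with rfl | rfl | rfl <;> rcases h3 y with rfl | rfl | rfl
      all_goals first
        | rfl
        | exact absurd hxy hmn | exact absurd hxy.symm hmn | exact absurd hxy hM | exact absurd hxy.symm hM
        | exact absurd hxy hN | exact absurd hxy.symm hN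
  · -- quintuple `{i,j,k,m,n}`, single `l`
    refine use ![l, i, j, k, m, n]
      (injective_vec6 l i j k m n hli hlj hlk (Ne.symm hml) (Ne.symm hnl) hij hik (Ne.symm hmi) (Ne.symm hni) hjk (Ne.symm hmj) (Ne.symm hnj)
        (Ne.symm hmk) (Ne.symm hnk) (Ne.symm hnm)) ?_
    intro δs δ0 hδs hδ0 U hU hne' z' hz' hroot'
    subst hδ0
    exact h51 δs _ hδs (by simp [hδij]) (by simp [hδik]) (by simp [hM]) (by simp [hN]) (by simpa using hL) U hU hne' z' hz' hroot'
  · -- quadruple `{i,j,k,m}`; letters `l, n`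
    by_cases hln : δ l = δ n
    · refine use ![l, n, i, j, k, m]
        (injective_vec6 l n i j k m (Ne.symm hnl) hli hlj hlk (Ne.symm hml) hni hnj hnk hnm hij hik (Ne.symm hmi) hjk (Ne.symm hmj)
          (Ne.symm hmk)) ?_
      intro δs δ0 hδs hδ0 U hU hne' z' hz' hroot'
      subst hδ0
      exact h42 δs _ hδs (by simp [hln]) (by simp [hδij]) (by simp [hδik]) (by simp [hM]) (by simpa using hL) U hU hne' z' hz' hroot'
    · refine use ![l, n, i, j, k, m]
        (injective_vec6 l n i j k m (Ne.symm hnl) hli hlj hlk (Ne.symm hml) hni hnj hnk hnm hij hik (Ne.symm hmi) hjk (Ne.symm hmj)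
          (Ne.symm hmk)) ?_
      intro δs δ0 hδs hδ0 U hU hne' z' hz' hroot'
      subst hδ0
      refine h411 δs _ hδs (by simp [hδij]) (by simp [hδik]) (by simp [hM]) ?_ U hU hne' z' hz' hroot'
      refine valueGeneric_transfer δ hV (fun a => ![l, n, i, j, k, m] a.castSucc.castSucc.castSucc) ?_
      intro x y hxy
      rcases h3 x with rfl | rfl | rfl <;> rcases h3 y with rfl | rfl | rfl
      all_goals first
        | rfl
        | exact absurd hxy hln | exact absurd hxy.symm hln | exact absurd hxy hL | exact absurd hxy.symm hL
        | exact absurd hxy hN | exact absurd hxy.symm hN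
  · -- quadruple `{i,j,k,n}`; letters `l, m`
    by_cases hlm : δ l = δ m
    · refine use ![l, m, i, j, k, n]
        (injective_vec6 l m i j k n (Ne.symm hml) hli hlj hlk (Ne.symm hnl) hmi hmj hmk (Ne.symm hnm) hij hik (Ne.symm hni) hjk (Ne.symm hnj)
          (Ne.symm hnk)) ?_
      intro δs δ0 hδs hδ0 U hU hne' z' hz' hroot'
      subst hδ0
      exact h42 δs _ hδs (by simp [hlm]) (by simp [hδij]) (by simp [hδik]) (by simp [hN]) (by simpa using hL) U hU hne' z' hz' hroot'
    · refine use ![l, m, i, j, k, n]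
        (injective_vec6 l m i j k n (Ne.symm hml) hli hlj hlk (Ne.symm hnl) hmi hmj hmk (Ne.symm hnm) hij hik (Ne.symm hni) hjk (Ne.symm hnj)
          (Ne.symm hnk)) ?_
      intro δs δ0 hδs hδ0 U hU hne' z' hz' hroot'
      subst hδ0
      refine h411 δs _ hδs (by simp [hδij]) (by simp [hδik]) (by simp [hN]) ?_ U hU hne' z' hz' hroot'
      refine valueGeneric_transfer δ hV (fun a => ![l, m, i, j, k, n] a.castSucc.castSucc.castSucc) ?_
      intro x y hxy
      rcases h3 x with rfl | rfl | rfl <;> rcases h3 y with rfl | rfl | rfl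
      all_goals first
        | rfl
        | exact absurd hxy hlm | exact absurd hxy.symm hlm | exact absurd hxy hL | exact absurd hxy.symm hL
        | exact absurd hxy hM | exact absurd hxy.symm hM
  · -- (4) exactly a triple; the letters `l, m, n` are off the value
    have hg : Function.Injective ![l, m, n, i, j, k] :=
      injective_vec6 l m n i j k (Ne.symm hml) (Ne.symm hnl) hli hlj hlk (Ne.symm hnm) hmi hmj hmk hni hnj hnk hij hik hjk
    by_cases hlm : δ l = δ m <;> by_cases hln : δ l = δ n
    · -- two triples
      refine use ![l, m, n, i, j, k] hg ?_
      intro δs δ0 hδs hδ0 U hU hne' z' hz' hroot'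
      subst hδ0
      exact h33 δs _ hδs (by simp [hlm]) (by simp [hln]) (by simp [hδij]) (by simp [hδik]) (by simpa using hL) U hU hne' z' hz' hroot'
    · -- pair `l, m`, single `n`
      refine use ![l, m, n, i, j, k] hg ?_
      intro δs δ0 hδs hδ0 U hU hne' z' hz' hroot'
      subst hδ0
      refine h321 δs _ hδs (by simp [hlm]) (by simp [hδij]) (by simp [hδik]) ?_ U hU hne' z' hz' hroot'
      refine valueGeneric_transfer δ hV (fun a => ![l, m, n, i, j, k] ((![0, 2, 3] : Fin 3 → Fin 6) a)) ?_
      intro x y hxy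
      rcases h3 x with rfl | rfl | rfl <;> rcases h3 y with rfl | rfl | rfl
      all_goals first
        | rfl
        | exact absurd hxy hln | exact absurd hxy.symm hln | exact absurd hxy hL | exact absurd hxy.symm hL
        | exact absurd hxy hN | exact absurd hxy.symm hN
    · -- pair `l, n`, single `m`
      have hg' : Function.Injective ![l, n, m, i, j, k] :=
        injective_vec6 l n m i j k (Ne.symm hnl) (Ne.symm hml) hli hlj hlk hnm hni hnj hnk hmi hmj hmk hij hik hjk
      refine use ![l, n, m, i, j, k] hg' ?_
      intro δs δ0 hδs hδ0 U hU hne' z' hz' hroot'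
      subst hδ0
      refine h321 δs _ hδs (by simp [hln]) (by simp [hδij]) (by simp [hδik]) ?_ U hU hne' z' hz' hroot'
      refine valueGeneric_transfer δ hV (fun a => ![l, n, m, i, j, k] ((![0, 2, 3] : Fin 3 → Fin 6) a)) ?_
      intro x y hxy
      rcases h3 x with rfl | rfl | rfl <;> rcases h3 y with rfl | rfl | rfl
      all_goals first
        | rfl
        | exact absurd hxy hlm | exact absurd hxy.symm hlm | exact absurd hxy hL | exact absurd hxy.symm hL
        | exact absurd hxy hM | exact absurd hxy.symm hM
    · by_cases hmn : δ m = δ n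
      · -- pair `m, n`, single `l`
        have hg' : Function.Injective ![m, n, l, i, j, k] :=
          injective_vec6 m n l i j k (Ne.symm hnm) hml hmi hmj hmk hnl hni hnj hnk hli hlj hlk hij hik hjk
        refine use ![m, n, l, i, j, k] hg' ?_
        intro δs δ0 hδs hδ0 U hU hne' z' hz' hroot'
        subst hδ0
        refine h321 δs _ hδs (by simp [hmn]) (by simp [hδij]) (by simp [hδik]) ?_ U hU hne' z' hz' hroot'
        refine valueGeneric_transfer δ hV (fun a => ![m, n, l, i, j, k] ((![0, 2, 3] : Fin 3 → Fin 6) a)) ?_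
        intro x y hxy
        rcases h3 x with rfl | rfl | rfl <;> rcases h3 y with rfl | rfl | rfl
        all_goals first
          | rfl
          | exact absurd hxy hlm | exact absurd hxy.symm hlm | exact absurd hxy hM | exact absurd hxy.symm hM
          | exact absurd hxy hL | exact absurd hxy.symm hL
      · -- [3,1,1,1]: the four values `δ l, δ m, δ n, δ i` are pairwise distinct
        refine use ![l, m, n, i, j, k] hg ?_
        intro δs δ0 hδs hδ0 U hU hne' z' hz' hroot'
        subst hδ0
        refine h3111 δs _ hδs (by simp [hδij]) (by simp [hδik]) ?_ U hU hne' z' hz' hroot'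
        refine valueGeneric_transfer δ hV (fun a => ![l, m, n, i, j, k] a.castSucc.castSucc) ?_
        intro x y hxy
        rcases h4 x with rfl | rfl | rfl | rfl <;> rcases h4 y with rfl | rfl | rfl | rfl
        all_goals first
          | rfl
          | exact absurd hxy hlm | exact absurd hxy.symm hlm | exact absurd hxy hln | exact absurd hxy.symm hln
          | exact absurd hxy hmn | exact absurd hxy.symm hmn | exact absurd hxy hL | exact absurd hxy.symm hL
          | exact absurd hxy hM | exact absurd hxy.symm hM | exact absurd hxy hN | exact absurd hxy.symm hN

end Summit.ValiantsHypothesis.ValiantsHypothesis.Theorems.LacunarySymmetroidMatrixDescartes.WallBubbling
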